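import Summits.AtomisticToContinuum.HydrodynamicLimit.Theorems.TransferActivityTails.Negative.EquilibriumReduction
import Summits.AtomisticToContinuum.HydrodynamicLimit.Theorems.OneFlightGossipEngineCollisionActivityTailsEndpointTails
import Summits.AtomisticToContinuum.HydrodynamicLimit.Theorems.OneFlightGossipEngineCollisionActivityTailsActMeasurable
import HarnessLib

/-!
# `TransferActivityTails` (stmt-AtomisticToContinuum-16624), line `Sketch` (card `predictor-drift-doob`):
# stub `stub_windowSandwich` — the window collision sum of the transfer summand is monotone in the window

Helper file (`--supports stmt-AtomisticToContinuum-16624`) for the crux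
`Summit.AtomisticToContinuum.HydrodynamicLimit.Theses.TwoClocks.TransferActivityTails`, skeleton line `Sketch`
(`Cruxes/TransferActivityTails/Lines/Sketch.lean`), registered stub `stub_windowSandwich : WindowSandwich`.

Kinematics on the good set of the flow.  For a good datum `z ∈ Φ.good` every bounded window carries finitely many
collision times (`HardSphereFlow.finite_collisionTimes_inter`), so the collision sum along the orbit is additive over
adjacent windows `(a, c] = (a, b] ∪ (b, c]` (`collisionPairSum_union`; `collisionSum_Ioc_add`), and for a NONNEGATIVE
per-record summand it is monotone in the right endpoint (`collisionPairSum_nonneg`; `collisionSum_Ioc_mono`).  The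
crux's window `window τ N = τ (N+1)^{-1/3}` is nonnegative and monotone in `τ` (`window_nonneg`, and the landed
`CollisionActivityTailsWindowAlgebra.window_le_window`), and the transfer summand `transferOf N i` is nonnegative
(`transferOf_nonneg`); whence `stub_windowSandwich`.  Same argument as
`CollisionActivityTailsWindowAlgebra.impulse_Ioc_add` / `impulse_Ioc_mono` (the momentum summand of ex-stmt-13734),
ported to a general summand.

References: C. Cercignani, R. Illner, M. Pulvirenti, *The Mathematical Theory of Dilute Gases* (1994), §4.2,
App. 4.A (the hard-sphere flow, sums along it).  The lemmas themselves are elementary and recorded here.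
-/

noncomputable section

open MeasureTheory Filter Set Topology
open scoped ENNReal BigOperators

namespace Summit.AtomisticToContinuum.HydrodynamicLimit.Theorems.TransferActivityTailsDriftWindowSandwich

open Literature.MathematicalPhysics.KineticTheory Literature.Analysis.FluidPDE
open Summit.AtomisticToContinuum.HydrodynamicLimit.Theorems.TransferActivityTailsNegative (Flow Rec transferOf)
open Summit.AtomisticToContinuum.HydrodynamicLimit.Theorems.CollisionActivityTailsEndpointTails
  (Cfg window ae_mem_good_localGibbsLaw)
open Summit.AtomisticToContinuum.HydrodynamicLimit.Theorems.CollisionActivityTailsWindowAlgebra (window_le_window)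

variable {σ : ℝ} {N : ℕ}

/-! ## Window algebra of collision sums on the good set -/

/-- **Additivity over adjacent windows** `(a, c] = (a, b] ∪ (b, c]` of the collision sum along the flow, on the good
set (finitely many collision times in bounded windows). -/
theorem collisionSum_Ioc_add {M : Type*} [AddCommMonoid M] (Φ : Flow σ N) {z : Cfg N} (hz : z ∈ Φ.good)
    {a b c : ℝ} (hab : a ≤ b) (hbc : b ≤ c) (F : Rec N → M) :
    Φ.collisionSum (Ioc a c) F z = Φ.collisionSum (Ioc a b) F z + Φ.collisionSum (Ioc b c) F z := by
  -- adapted from `CollisionActivityTailsWindowAlgebra.impulse_Ioc_add` (momentum summand, ex-stmt-13734)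
  rw [HardSphereFlow.collisionSum_eq, HardSphereFlow.collisionSum_eq, HardSphereFlow.collisionSum_eq,
    Literature.Analysis.FluidPDE.collisionSum_eq_collisionPairSum,
    Literature.Analysis.FluidPDE.collisionSum_eq_collisionPairSum,
    Literature.Analysis.FluidPDE.collisionSum_eq_collisionPairSum, ← Ioc_union_Ioc_eq_Ioc hab hbc,
    collisionPairSum_union (Φ.finite_collisionTimes_inter hz Ioc_subset_Icc_self)
      (Φ.finite_collisionTimes_inter hz Ioc_subset_Icc_self) (Ioc_disjoint_Ioc_of_le le_rfl)]

/-- **Monotonicity in the right endpoint** of the collision sum of a nonnegative summand along the flow, on the good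
set. -/
theorem collisionSum_Ioc_mono (Φ : Flow σ N) {z : Cfg N} (hz : z ∈ Φ.good) {a b c : ℝ} (hab : a ≤ b)
    (hbc : b ≤ c) {F : Rec N → ℝ} (hF : ∀ r, 0 ≤ F r) :
    Φ.collisionSum (Ioc a b) F z ≤ Φ.collisionSum (Ioc a c) F z := by
  rw [collisionSum_Ioc_add Φ hz hab hbc F]
  exact le_add_of_nonneg_right (TransferActivityTailsNegative.collisionSum_nonneg Φ (Ioc b c) hF z)

/-- The crux's window `τ (N+1)^{-1/3}` is nonnegative for `τ ≥ 0`. -/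
theorem window_nonneg {τ : ℝ} (hτ : 0 ≤ τ) (N : ℕ) : 0 ≤ window τ N := by
  unfold window
  exact mul_nonneg hτ (Real.rpow_pos_of_pos (by positivity) _).le

/-! ## The registered statement (verbatim from the line skeleton) and its proof -/

/-- **Window sandwich** (kinematics on the good set): the window collision sum of the nonnegative transfer summand
is monotone in the window length. -/
def WindowSandwich : Prop :=
  ∀ (σ : ℝ) (N : ℕ) (Φ : Flow σ N) (z : Cfg N), z ∈ Φ.good → ∀ (s : ℝ) (i : Fin (N + 1)) (τ τ' : ℝ),
    0 ≤ τ → τ ≤ τ' →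
    Φ.collisionSum (Set.Ioc s (s + window τ N)) (transferOf N i) z ≤
      Φ.collisionSum (Set.Ioc s (s + window τ' N)) (transferOf N i) z

/-- **STUB `stub_windowSandwich` (line `Sketch`)**: on the good set, for `0 ≤ τ ≤ τ'`, the collision sum of the
transfer summand over `(s, s + window τ N]` is at most the one over `(s, s + window τ' N]`
(`s ≤ s + window τ N ≤ s + window τ' N`, additivity over the two adjacent pieces, nonnegativity of the second). -/
theorem stub_windowSandwich : WindowSandwich := fun _σ N Φ _z hz s i _τ _τ' hτ hττ' =>
  collisionSum_Ioc_mono Φ hz (le_add_of_nonneg_right (window_nonneg hτ N))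
    (add_le_add (le_refl s) (window_le_window hττ' N))
    (TransferActivityTailsNegative.transferOf_nonneg N i)

end Summit.AtomisticToContinuum.HydrodynamicLimit.Theorems.TransferActivityTailsDriftWindowSandwich

end
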